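import Summits.Ventures.PercRepro.Night2ThreeTwoQSumRange
import Summits.Ventures.PercRepro.Night2ThreeTwoBasisCell

/-!
# PercRepro — **THE `(3, 2)` OBSTRUCTION CELL IS CLOSED FOR `|V| ≥ 12`; THE `(7, 5)` SHADOW ROW MODULO THE RESIDUES Y**
(night-2, gen 25)

The obstruction cell — `|E ∖ G| = 3`, two coloops, a fat non-basis member and a saturated middle target — with
`|V| ≥ 12` satisfies (LI_G): the column bound of the missed-point routing holds at every target
(`dload_missed_le_cap2_three_two`), the basis pairs' inequality follows from the quadratic count sums
(`localShadowHall_three_two_five_of_qSums`), and those sums hold for every `n ≥ 12` (`E_le_qSum_of_twelve`).  The two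
thin covering preimages of the saturated target are thin members missing `≤ 3` points with distinct hyperplanes, whose
common line `ℓ` has `|V ∖ ℓ| ∈ [3, 6]`.

* `saturated_faces_three_two`: a saturated middle target has two thin covering preimages missing `≤ 3` points, with
  distinct closures;
* **`localShadowHall_three_two_five_twelve`**: (LI_G) in the obstruction cell with `|V| ≥ 12`
  (`localShadowHall_three_two_five_thirteen`: its restriction);
* **`shadowHall_seven_five_of_residuesY`**: `ShadowHall M 7 5 (phiK 7 5)` for every finite matroid modulo `(2, 0)`,
  `(2, 1)` as in the residues V and the `(3, 2)` obstruction cells with `|V| ≤ 11`.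
-/

namespace PercRepro.Shadow

open Finset PerFlat ThmH

variable {α : Type*} [DecidableEq α] {M : Matroid α} [M.Finite]

section Thirteen

variable {G : Finset α}

open scoped Classical in
/-- A saturated middle target of the cell `(3, 2)` has two thin covering preimages, each missing at most three points,
with distinct closures (`L1 ≤ 7/15` needs two requests `> 5/12 − 7/30`). -/
theorem saturated_faces_three_two (hG : G ∈ flatsQ M (5 + 1)) (hd : (gr M \ G).card = 3) (hk : kColoops M G = 2)
    (hs : ∀ e ∈ gr M, ∀ f ∈ gr M, e ≠ f → rkN M {e, f} = 2) (hl : ∀ e ∈ gr M, M.Indep {e}) {S : Finset α}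
    (hS : S ∈ shadowAt M (5 + 2) 5 (Uq M (5 + 2) 5) G) (hcard : 4 + 1 ≤ (S \ coloops M G).card)
    (hsat : capS M 5 G S < L1 M 5 G S) :
    ∃ B₁ ∈ thinMembers M 5 G, ∃ B₂ ∈ thinMembers M 5 G, (G \ clF M B₁).card ≤ 3 ∧ (G \ clF M B₂).card ≤ 3 ∧
      clF M B₁ ≠ clF M B₂ := by
  have hd' : (gr M \ G).card ≤ 5 := by omega
  have hk' : kColoops M G + 4 = 5 + 1 := by omega
  set P := (coverPreimages M (Uq M (5 + 2) 5) G S).filter (fun B => B ∉ lay0 M 5 G) with hP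
  have hL1 : L1 M 5 G S = ∑ B ∈ P, req M 5 B := rfl
  have hPcard : P.card + 2 ≤ 4 := card_thin_coverPreimages_add_two_le hG hd' hk' hs hl hS hcard
  have hthin : ∀ B ∈ P, B ∈ thinMembers M 5 G := by
    intro B hB
    rw [hP, Finset.mem_filter, mem_coverPreimages] at hB
    exact mem_thinMembers.2 ⟨hB.1.1, hB.2⟩
  have hcap := capS_ge_five_twelfths_three_two hd hk (subset_G_of_mem_shadowAt hS)
  have hreq : ∀ B ∈ P, req M 5 B ≤ 7 / 30 := fun B hB => req_le_of_thin_three_two hG hd (hthin B hB)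
  -- `P` has exactly two members
  have hP2 : P.card = 2 := by
    by_contra hne
    have h1 : P.card ≤ 1 := by omega
    have : L1 M 5 G S ≤ 7 / 30 := by
      rw [hL1]
      calc ∑ B ∈ P, req M 5 B ≤ ∑ _B ∈ P, (7 / 30 : ℚ) := Finset.sum_le_sum hreq
        _ = (P.card : ℚ) * (7 / 30) := by rw [Finset.sum_const, nsmul_eq_mul]
        _ ≤ 1 * (7 / 30) := by
            have : (P.card : ℚ) ≤ 1 := by exact_mod_cast h1
            nlinarith
        _ = 7 / 30 := by norm_num
    linarith
  obtain ⟨B₁, B₂, hne, hPeq⟩ := Finset.card_eq_two.1 hP2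
  have hB₁ : B₁ ∈ P := by rw [hPeq]; simp
  have hB₂ : B₂ ∈ P := by rw [hPeq]; simp
  -- each request is `> 5/12 − 7/30 = 11/60`, i.e. `m ≤ 3`
  have hreq_gt : ∀ B ∈ P, (11 / 60 : ℚ) < req M 5 B := by
    intro B hB
    rw [hL1, hPeq, Finset.sum_pair hne] at hsat
    rw [hPeq, Finset.mem_insert, Finset.mem_singleton] at hB
    rcases hB with rfl | rfl
    · have := hreq B₂ hB₂; linarith
    · have := hreq B₁ hB₁; linarith
  have hm : ∀ B ∈ P, (G \ clF M B).card ≤ 3 := by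
    intro B hB
    have h := hreq_gt B hB
    rw [req_eq_of_thin hG (hthin B hB), hd] at h
    by_contra h4
    push Not at h4
    have h4' : (4 : ℚ) ≤ ((G \ clF M B).card : ℚ) := by exact_mod_cast h4
    unfold phiQ at h
    push_cast at h
    rw [lt_div_iff₀ (by linarith)] at h
    linarith
  refine ⟨B₁, hthin B₁ hB₁, B₂, hthin B₂ hB₂, hm B₁ hB₁, hm B₂ hB₂, ?_⟩
  intro h
  have hB₁' : B₁ ∈ coverPreimages M (Uq M (5 + 2) 5) G S := (Finset.mem_filter.1 (hP ▸ hB₁)).1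
  have hB₂' : B₂ ∈ coverPreimages M (Uq M (5 + 2) 5) G S := (Finset.mem_filter.1 (hP ▸ hB₂)).1
  exact hne (clF_injOn_coverPreimages hB₁' hB₂' h)

open scoped Classical in
/-- **THE `(3, 2)` OBSTRUCTION CELL WITH `|V| ≥ 12` SATISFIES (LI_G).** -/
theorem localShadowHall_three_two_five_twelve (hG : G ∈ flatsQ M (5 + 1)) (hd : (gr M \ G).card = 3)
    (hk : kColoops M G = 2) (hs : ∀ e ∈ gr M, ∀ f ∈ gr M, e ≠ f → rkN M {e, f} = 2)
    (hl : ∀ e ∈ gr M, M.Indep {e}) (h13 : 12 ≤ (G \ coloops M G).card)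
    (hsat : ∃ S ∈ shadowAt M (5 + 2) 5 (Uq M (5 + 2) 5) G, 4 + 1 ≤ (S \ coloops M G).card ∧
      capS M 5 G S < L1 M 5 G S) :
    LocalShadowHall M 5 G := by
  have hd' : (gr M \ G).card ≤ 5 := by omega
  obtain ⟨S, hS, hcard, hsat⟩ := hsat
  obtain ⟨B₁, hthin₁, B₂, hthin₂, hm₁, hm₂, hne⟩ := saturated_faces_three_two hG hd hk hs hl hS hcard hsat
  set n := (G \ coloops M G).card with hn
  set ℓ := (clF M B₁ ∩ clF M B₂) \ coloops M G with hℓdef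
  have hℓV : ℓ ⊆ G \ coloops M G := fun a ha =>
    Finset.mem_sdiff.2 ⟨(mem_membersIn.1 (mem_thinMembers.1 hthin₁).1).2
      (Finset.mem_inter.1 (Finset.mem_sdiff.1 ha).1).1, (Finset.mem_sdiff.1 ha).2⟩
  set y := ((G \ coloops M G) \ ℓ).card with hy
  have hLy : ℓ.card = n - y := by
    rw [hy, Finset.card_sdiff_of_subset hℓV]
    have := Finset.card_le_card hℓV
    omega
  -- `|ℓ| ≥ n − 6`, so `y ≤ 6`
  have hℓ6 : n - 6 ≤ ℓ.card := by
    have hsub : ((G \ coloops M G) \ (G \ clF M B₁)) \ (G \ clF M B₂) ⊆ ℓ := by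
      intro a ha
      simp only [Finset.mem_sdiff, not_and, not_not] at ha
      obtain ⟨⟨⟨haG, haK⟩, h1⟩, h2⟩ := ha
      exact Finset.mem_sdiff.2 ⟨Finset.mem_inter.2 ⟨h1 haG, h2 haG⟩, haK⟩
    have hc := Finset.card_le_card hsub
    have e1 := Finset.le_card_sdiff (G \ clF M B₁) (G \ coloops M G)
    have e2 := Finset.le_card_sdiff (G \ clF M B₂) ((G \ coloops M G) \ (G \ clF M B₁))
    omega
  have hy6 : y ≤ 6 := by omega
  -- `y ≥ 3`: the two missed sets are distinct subsets of `V ∖ ℓ` of size `≥ 2`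
  have hy3 : 3 ≤ y := by
    have hπ : ∀ B ∈ thinMembers M 5 G, ℓ ⊆ clF M B → G \ clF M B ⊆ (G \ coloops M G) \ ℓ := by
      intro B hB hℓB a ha
      rw [Finset.mem_sdiff] at ha
      have hK : coloops M G ⊆ B := coloops_subset_of_mem_thinMembers hG hd' hB
      have hBU : B ∈ Uq M (5 + 2) 5 := (mem_membersIn.1 (mem_thinMembers.1 hB).1).1
      refine Finset.mem_sdiff.2 ⟨Finset.mem_sdiff.2 ⟨ha.1, fun haK => ha.2 (subset_clF hBU (hK haK))⟩,
        fun haℓ => ha.2 (hℓB haℓ)⟩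
    have hℓ1 : ℓ ⊆ clF M B₁ := fun a ha => (Finset.mem_inter.1 (Finset.mem_sdiff.1 ha).1).1
    have hℓ2 : ℓ ⊆ clF M B₂ := fun a ha => (Finset.mem_inter.1 (Finset.mem_sdiff.1 ha).1).2
    have hsub : (G \ clF M B₁) ∪ (G \ clF M B₂) ⊆ (G \ coloops M G) \ ℓ :=
      Finset.union_subset (hπ B₁ hthin₁ hℓ1) (hπ B₂ hthin₂ hℓ2)
    have hc := Finset.card_le_card hsub
    have hm₁2 : 2 ≤ (G \ clF M B₁).card :=
      two_le_card_sdiff_of_not_lay0 hG hd' (mem_thinMembers.1 hthin₁).1 (mem_thinMembers.1 hthin₁).2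
    have hm₂2 : 2 ≤ (G \ clF M B₂).card :=
      two_le_card_sdiff_of_not_lay0 hG hd' (mem_thinMembers.1 hthin₂).1 (mem_thinMembers.1 hthin₂).2
    have hneπ : G \ clF M B₁ ≠ G \ clF M B₂ := by
      intro h
      apply hne
      have hH₁ : clF M B₁ ⊆ G := (mem_membersIn.1 (mem_thinMembers.1 hthin₁).1).2
      have hH₂ : clF M B₂ ⊆ G := (mem_membersIn.1 (mem_thinMembers.1 hthin₂).1).2
      rw [← Finset.sdiff_sdiff_eq_self hH₁, ← Finset.sdiff_sdiff_eq_self hH₂, h]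
    have hu := Finset.card_union_add_card_inter (G \ clF M B₁) (G \ clF M B₂)
    have hlt : ((G \ clF M B₁) ∩ (G \ clF M B₂)).card < (G \ clF M B₁).card ∨
        ((G \ clF M B₁) ∩ (G \ clF M B₂)).card < (G \ clF M B₂).card := by
      by_contra hcon
      push Not at hcon
      have e1 : (G \ clF M B₁) ∩ (G \ clF M B₂) = G \ clF M B₁ :=
        Finset.eq_of_subset_of_card_le Finset.inter_subset_left hcon.1
      have e2 : (G \ clF M B₁) ∩ (G \ clF M B₂) = G \ clF M B₂ :=
        Finset.eq_of_subset_of_card_le Finset.inter_subset_right hcon.2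
      exact hneπ (e1.symm.trans e2)
    omega
  apply localShadowHall_three_two_five_of_qSums hG hd hk hs hl (by omega) hthin₁ hthin₂ hm₁ hm₂ hne
  intro i₀ j₀ hi₀ hij hj₀
  rw [← hℓdef, hLy]
  exact E_le_qSum_of_twelve n y i₀ j₀ h13 hy3 hy6 hi₀ hij hj₀

open scoped Classical in
/-- The cell with `|V| ≥ 13`. -/
theorem localShadowHall_three_two_five_thirteen (hG : G ∈ flatsQ M (5 + 1)) (hd : (gr M \ G).card = 3)
    (hk : kColoops M G = 2) (hs : ∀ e ∈ gr M, ∀ f ∈ gr M, e ≠ f → rkN M {e, f} = 2)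
    (hl : ∀ e ∈ gr M, M.Indep {e}) (h13 : 13 ≤ (G \ coloops M G).card)
    (hsat : ∃ S ∈ shadowAt M (5 + 2) 5 (Uq M (5 + 2) 5) G, 4 + 1 ≤ (S \ coloops M G).card ∧
      capS M 5 G S < L1 M 5 G S) :
    LocalShadowHall M 5 G :=
  localShadowHall_three_two_five_twelve hG hd hk hs hl (by omega) hsat

end Thirteen

section SevenFiveY

variable {α' : Type} [DecidableEq α']

open scoped Classical in
/-- **THE `(7, 5)` SHADOW ROW FOR EVERY FINITE MATROID MODULO THE RESIDUES Y**: `(2, 0)`, `(2, 1)` as in the residues V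
and, at `(3, 2)`, only the obstruction cells with at most `11` points off the coloops. -/
theorem shadowHall_seven_five_of_residuesY
    (h20 : ∀ (N : Matroid α') [N.Finite] (G : Finset α'), CellHyp N G →
      (gr N \ G).card = 2 → kColoops N G = 0 → FatMember N G 6 3 →
      (FatBasis N G 6 2 ∨ FatMember N G 6 2) →
      (2 ≤ (fatClosures N 5 G 2).card ∨
        ∃ B ∈ thinMembers N 5 G, 2 < (G \ clF N B).card ∧ (G \ clF N B).card < 5) →
      LocalShadowHall N 5 G)
    (h21 : ∀ (N : Matroid α') [N.Finite] (G : Finset α'), CellHyp N G →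
      (gr N \ G).card = 2 → kColoops N G = 1 → FatMember N G 5 4 →
      (FatBasis N G 5 3 ∨ FatMember N G 5 3) →
      (2 ≤ (fatClosures N 5 G 2).card ∨
        ∃ B ∈ thinMembers N 5 G, 2 < (G \ clF N B).card ∧ (G \ clF N B).card < 7) →
      LocalShadowHall N 5 G)
    (h32 : ∀ (N : Matroid α') [N.Finite] (G : Finset α'), CellHyp N G →
      (gr N \ G).card = 3 → kColoops N G = 2 → FatMember N G 4 2 →
      (∃ S ∈ shadowAt N (5 + 2) 5 (Uq N (5 + 2) 5) G, 4 + 1 ≤ (S \ coloops N G).card ∧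
        capS N 5 G S < L1 N 5 G S) →
      (G \ coloops N G).card ≤ 11 → LocalShadowHall N 5 G)
    (M : Matroid α') [M.Finite] : ShadowHall M 7 5 (phiK 7 5) := by
  apply shadowHall_seven_five_of_residuesW h20 h21
  intro N _ G hcell hd hk hfm hsat
  by_cases h11 : (G \ coloops N G).card ≤ 11
  · exact h32 N G hcell hd hk hfm hsat h11
  · push Not at h11
    exact localShadowHall_three_two_five_twelve hcell.2.2.2 hd hk hcell.1 hcell.2.1 (by omega) hsat

end SevenFiveY

end PercRepro.Shadow
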